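import Summits.Ventures.HodgeKum4.FixedLocus
import Summits.Ventures.HodgeKum4.Invariants
import Summits.Ventures.HodgeKum4.Theorems.KummerFixedLocusDefs
import Literature.AlgebraicGeometry.HodgeTheory.CanonicalTrace
import Literature.AlgebraicGeometry.HodgeTheory.PolarizationClassExistence
import Literature.AlgebraicGeometry.HodgeTheory.DualLefschetzInLefschetzInvolutionAlgebra
import Literature.AlgebraicGeometry.Hyperkaehler.LLVGeneration
import Literature.AlgebraicGeometry.Hyperkaehler.LLVStructureKummerType
import HarnessLib

/-!
# A5 from L1: the Kummer involution acts as `(−1)^{deg}` on the `⟨Λ, ∪⟩`-span of `H⁰ + H² + H³`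
(cell `hodge-kum4`, seat p2)

HONEST FRAMING.  PROVED: the formal "parity lemma" and, with it,
`Andre1996_dualLefschetz_mem_adjoin_lefschetzInvolution → LefschetzGenerationKum4 → (ι^* fixes H⁸(X(ℂ); ℂ)^Γ)`
(inputs: André's dual-Lefschetz fact `Andre1996_dualLefschetz_mem_adjoin_lefschetzInvolution` — the guarded, printed form of S1 already in the tree — and L1, seat p1's crux; the route's own unguarded `PolarizationHasDualLefschetz` is not used).

Parity lemma (`totalPullback_eq_parityOp_of_mem_opCupSpan`): let `f` be a self-map of `Y = X(ℂ)`
(`X` smooth projective) whose pull-back `T = f^*` on `H*(Y; ℂ)` has a two-sided inverse `g^*`, with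
`f^* = id` on `H⁰, H²`, `f^* = −1` on `H³`, `g^* ℓ = ℓ`, and let `(L_ℓ, h, Λ)` be an `sl(2)`-triple.
Then `f^* = P` on the `⟨Λ, ∪⟩`-span of `H⁰ ∪ H² ∪ H³`, `P = (−1)^k` on `Hᵏ`:
`S = {v | f^* v = P v}` is cup-closed (both multiplicative), `Λ`-stable (`f^*` commutes with `Λ` by
uniqueness of `sl(2)`-partners, `IsDualLefschetz.unique`; `P` commutes with `Λ` because `Λ` lowers
the degree by exactly `2`, `⁅h, Λ⁆ = −2Λ` read componentwise), and contains the generators.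
In degree `8` the parity is `+1`, whence A5.
-/

noncomputable section

open DirectSum CategoryTheory
open Literature.AlgebraicTopology.SingularHomology
open Literature.AlgebraicGeometry Literature.AlgebraicGeometry.HodgeTheory
open Literature.AlgebraicGeometry.Hyperkaehler
open Literature.Geometry.Kaehler

attribute [local instance 100] LieRing.ofAssociativeRing

namespace Summit.Ventures.HodgeKum4

universe u

section Parity

variable {Y : Type u} [TopologicalSpace Y]

/-! ### Components of `h` and of the parity operator -/

/-- The degree-`m` component of `h w` is `(m - N) w_m`. -/
theorem degreeOperator_apply_apply (N : ℕ) (w : totalCohomology ℂ Y) (m : ℕ) :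
    (degreeOperator ℂ Y N w) m = ((m : ℂ) - N) • w m := by
  induction w using DirectSum.induction_on with
  | zero => simp only [map_zero, DirectSum.zero_apply, smul_zero]
  | of i y =>
    rw [← DirectSum.lof_eq_of ℂ, show lof ℂ ℕ (fun k ↦ singularCohomology ℂ ℂ Y k) i y =
      ofDegree ℂ Y i y from rfl, degreeOperator_lof]
    by_cases hi : i = m
    · subst hi
      simp only [ofDegree, DirectSum.lof_eq_of, DirectSum.smul_apply, DirectSum.of_eq_same]
    · simp only [ofDegree, DirectSum.lof_eq_of, DirectSum.smul_apply,
        DirectSum.of_eq_of_ne (β := fun k ↦ singularCohomology ℂ ℂ Y k) i m y (Ne.symm hi), smul_zero]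
  | add w w' hw hw' => rw [map_add, DirectSum.add_apply, DirectSum.add_apply, hw, hw', smul_add]

/-- `P` on a homogeneous class. -/
@[simp]
theorem parityOp_lof (k : ℕ) (x : singularCohomology ℂ ℂ Y k) :
    parityOp Y (ofDegree ℂ Y k x) = ((-1 : ℂ) ^ k) • ofDegree ℂ Y k x := by
  simp only [parityOp, toModule_lof, LinearMap.smul_apply]

/-- The degree-`m` component of `P w` is `(-1)^m w_m`. -/
theorem parityOp_apply_apply (w : totalCohomology ℂ Y) (m : ℕ) :
    (parityOp Y w) m = ((-1 : ℂ) ^ m) • w m := by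
  induction w using DirectSum.induction_on with
  | zero => simp only [map_zero, DirectSum.zero_apply, smul_zero]
  | of i y =>
    rw [← DirectSum.lof_eq_of ℂ, show lof ℂ ℕ (fun k ↦ singularCohomology ℂ ℂ Y k) i y =
      ofDegree ℂ Y i y from rfl, parityOp_lof]
    by_cases hi : i = m
    · subst hi
      simp only [ofDegree, DirectSum.lof_eq_of, DirectSum.smul_apply, DirectSum.of_eq_same]
    · simp only [ofDegree, DirectSum.lof_eq_of, DirectSum.smul_apply,
        DirectSum.of_eq_of_ne (β := fun k ↦ singularCohomology ℂ ℂ Y k) i m y (Ne.symm hi), smul_zero]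
  | add w w' hw hw' => rw [map_add, DirectSum.add_apply, DirectSum.add_apply, hw, hw', smul_add]

/-- `P` is multiplicative for the total cup product. -/
theorem parityOp_totalCup (v w : totalCohomology ℂ Y) :
    parityOp Y (totalCup ℂ Y v w) = totalCup ℂ Y (parityOp Y v) (parityOp Y w) := by
  suffices h : (totalCup ℂ Y).compr₂ (parityOp Y) =
      ((totalCup ℂ Y).comp (parityOp Y)).compl₂ (parityOp Y) by
    have := LinearMap.congr_fun₂ h v w
    simpa only [LinearMap.compr₂_apply, LinearMap.compl₂_apply, LinearMap.comp_apply] using this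
  refine linearMap_ext ℂ fun p ↦ LinearMap.ext fun x ↦ linearMap_ext ℂ fun q ↦ LinearMap.ext fun y ↦ ?_
  simp only [LinearMap.coe_comp, Function.comp_apply, LinearMap.compr₂_apply, LinearMap.compl₂_apply,
    totalCup_lof, parityOp_lof, map_smul, LinearMap.smul_apply, smul_smul, pow_add]
  rw [mul_comm]

/-! ### Pull-backs on `H*` -/

/-- `f^*` is multiplicative for the total cup product (`cupProduct_map` degreewise). -/
theorem totalPullback_totalCup {Y' : Type u} [TopologicalSpace Y'] (f : C(Y, Y'))
    (v w : totalCohomology ℂ Y') :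
    totalPullback ℂ f (totalCup ℂ Y' v w) =
      totalCup ℂ Y (totalPullback ℂ f v) (totalPullback ℂ f w) := by
  suffices h : (totalCup ℂ Y').compr₂ (totalPullback ℂ f) =
      ((totalCup ℂ Y).comp (totalPullback ℂ f)).compl₂ (totalPullback ℂ f) by
    have := LinearMap.congr_fun₂ h v w
    simpa only [LinearMap.compr₂_apply, LinearMap.compl₂_apply, LinearMap.comp_apply] using this
  refine linearMap_ext ℂ fun p ↦ LinearMap.ext fun x ↦ linearMap_ext ℂ fun q ↦ LinearMap.ext fun y ↦ ?_
  simp only [LinearMap.coe_comp, Function.comp_apply, LinearMap.compr₂_apply, LinearMap.compl₂_apply,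
    totalCup_lof, totalPullback_lof]
  congr 1
  exact cupProduct_map f rfl x y

/-- `(f ∘ g)^* = g^* f^*` on `H*` (as a product in `gl(H*)`, `Y' = Y`). -/
theorem totalPullback_comp_eq_mul (g f : C(Y, Y)) :
    totalPullback ℂ (f.comp g) = totalPullback ℂ g * totalPullback ℂ f := by
  refine linearMap_ext ℂ fun k ↦ LinearMap.ext fun x ↦ ?_
  simp only [LinearMap.coe_comp, Function.comp_apply, Module.End.mul_apply, totalPullback_lof,
    singularCohomology.map_comp, ModuleCat.comp_apply]

/-- `id^* = 1` on `H*`. -/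
theorem totalPullback_id_eq_one : totalPullback ℂ (ContinuousMap.id Y) = 1 := by
  refine linearMap_ext ℂ fun k ↦ LinearMap.ext fun x ↦ ?_
  simp only [LinearMap.coe_comp, Function.comp_apply, totalPullback_lof, singularCohomology.map_id,
    Module.End.one_apply]
  rfl

/-- `f^*` preserves degrees: it commutes with `h`. -/
theorem degreeOperator_mul_totalPullback (N : ℕ) (f : C(Y, Y)) :
    degreeOperator ℂ Y N * totalPullback ℂ f = totalPullback ℂ f * degreeOperator ℂ Y N := by
  refine linearMap_ext ℂ fun k ↦ LinearMap.ext fun x ↦ ?_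
  simp only [LinearMap.coe_comp, Function.comp_apply, Module.End.mul_apply, totalPullback_lof,
    degreeOperator_lof, map_smul]

/-- If `f^* ℓ = ℓ` then `f^*` commutes with `L_ℓ`. -/
theorem totalLefschetz_mul_totalPullback (f : C(Y, Y)) {ℓ : singularCohomology ℂ ℂ Y 2}
    (hℓ : singularCohomology.map ℂ ℂ f 2 ℓ = ℓ) :
    totalLefschetz ℓ * totalPullback ℂ f = totalPullback ℂ f * totalLefschetz ℓ := by
  refine linearMap_ext ℂ fun k ↦ LinearMap.ext fun x ↦ ?_
  simp only [LinearMap.coe_comp, Function.comp_apply, Module.End.mul_apply, totalPullback_lof,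
    totalLefschetz_lof, lefschetzOperator_apply]
  rw [cupProduct_map, hℓ]

/-- Conjugation `Λ ↦ f^* Λ g^*` by mutually inverse pull-backs fixing `ℓ` preserves dual Lefschetz
operators of `ℓ`. -/
theorem isDualLefschetz_conj_totalPullback {N : ℕ} (f g : C(Y, Y))
    (hfg : totalPullback ℂ f * totalPullback ℂ g = 1)
    {ℓ : singularCohomology ℂ ℂ Y 2} (hℓf : singularCohomology.map ℂ ℂ f 2 ℓ = ℓ)
    (hℓg : singularCohomology.map ℂ ℂ g 2 ℓ = ℓ) {Λ : Module.End ℂ (totalCohomology ℂ Y)}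
    (hΛ : IsDualLefschetz N ℓ Λ) :
    IsDualLefschetz N ℓ (totalPullback ℂ f * Λ * totalPullback ℂ g) := by
  have heT := totalLefschetz_mul_totalPullback f hℓf
  have heS := totalLefschetz_mul_totalPullback g hℓg
  have hhT := degreeOperator_mul_totalPullback N f
  have hhS := degreeOperator_mul_totalPullback N g
  refine ⟨hΛ.h_ne_zero, ?_, lie_degreeOperator_totalLefschetz N ℓ, ?_⟩
  · have e1 : ⁅totalLefschetz ℓ, totalPullback ℂ f * Λ * totalPullback ℂ g⁆ =
        totalPullback ℂ f * ⁅totalLefschetz ℓ, Λ⁆ * totalPullback ℂ g := by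
      rw [Ring.lie_def, Ring.lie_def, mul_sub, sub_mul, ← mul_assoc, ← mul_assoc, heT,
        mul_assoc (totalPullback ℂ f * Λ) (totalPullback ℂ g) (totalLefschetz ℓ), ← heS]
      simp only [mul_assoc]
    rw [e1, hΛ.lie_e_f, ← hhT, mul_assoc, hfg, mul_one]
  · have e1 : ⁅degreeOperator ℂ Y N, totalPullback ℂ f * Λ * totalPullback ℂ g⁆ =
        totalPullback ℂ f * ⁅degreeOperator ℂ Y N, Λ⁆ * totalPullback ℂ g := by
      rw [Ring.lie_def, Ring.lie_def, mul_sub, sub_mul, ← mul_assoc, ← mul_assoc, hhT,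
        mul_assoc (totalPullback ℂ f * Λ) (totalPullback ℂ g) (degreeOperator ℂ Y N), ← hhS]
      simp only [mul_assoc]
    have e2 : ∀ P Q : Module.End ℂ (totalCohomology ℂ Y),
        totalPullback ℂ f * (P - Q) * totalPullback ℂ g =
          totalPullback ℂ f * P * totalPullback ℂ g - totalPullback ℂ f * Q * totalPullback ℂ g :=
      fun P Q ↦ by rw [mul_sub, sub_mul]
    have e3 : ⁅degreeOperator ℂ Y N, Λ⁆ = 0 - (Λ + Λ) := by
      rw [hΛ.lie_h_f_nsmul, two_nsmul, zero_sub]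
    rw [e1, e3, e2, mul_zero, zero_mul, mul_add, add_mul, zero_sub, two_nsmul]

/-- **A dual Lefschetz operator lowers the degree by exactly `2`**: for `x ∈ Hᵏ` every component of
`Λ x` of degree `m` with `m + 2 ≠ k` vanishes. -/
theorem dual_lof_apply_eq_zero {N : ℕ} {ℓ : singularCohomology ℂ ℂ Y 2}
    {Λ : Module.End ℂ (totalCohomology ℂ Y)} (hΛ : IsDualLefschetz N ℓ Λ) (k : ℕ)
    (x : singularCohomology ℂ ℂ Y k) {m : ℕ} (hm : m + 2 ≠ k) :
    (Λ (ofDegree ℂ Y k x)) m = 0 := by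
  have h1 := LinearMap.congr_fun hΛ.lie_h_f_nsmul (ofDegree ℂ Y k x)
  rw [Ring.lie_def, LinearMap.sub_apply, Module.End.mul_apply, Module.End.mul_apply,
    degreeOperator_lof, map_smul, LinearMap.neg_apply, LinearMap.smul_apply,
    ← Nat.cast_smul_eq_nsmul ℂ, eq_neg_iff_add_eq_zero] at h1
  -- `h1 : h (Λ v) - (k - N) • Λ v + 2 • Λ v = 0`; read the component of degree `m`
  have h2 := congrArg (fun w : totalCohomology ℂ Y ↦ w m) h1
  simp only [DirectSum.add_apply, DirectSum.sub_apply, DirectSum.smul_apply, DirectSum.zero_apply,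
    degreeOperator_apply_apply, Nat.cast_ofNat] at h2
  have h3 : ((m : ℂ) - N - ((k : ℂ) - N) + 2) • (Λ (ofDegree ℂ Y k x)) m = 0 := by
    rw [add_smul, sub_smul]
    exact h2
  have hne : ((m : ℂ) - N - ((k : ℂ) - N) + 2) ≠ 0 := by
    have : ((m : ℂ) - N - ((k : ℂ) - N) + 2) = ((m + 2 : ℕ) : ℂ) - (k : ℕ) := by push_cast; ring
    rw [this, sub_ne_zero]
    exact_mod_cast hm
  exact (smul_eq_zero.mp h3).resolve_left hne

/-- **`Λ` preserves parity**: `P Λ = Λ P`. -/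
theorem parityOp_mul_dual {N : ℕ} {ℓ : singularCohomology ℂ ℂ Y 2}
    {Λ : Module.End ℂ (totalCohomology ℂ Y)} (hΛ : IsDualLefschetz N ℓ Λ) :
    parityOp Y * Λ = Λ * parityOp Y := by
  refine linearMap_ext ℂ fun k ↦ LinearMap.ext fun x ↦ ?_
  simp only [LinearMap.coe_comp, Function.comp_apply, Module.End.mul_apply, parityOp_lof, map_smul]
  refine DFinsupp.ext fun m ↦ ?_
  rw [parityOp_apply_apply, DirectSum.smul_apply]
  by_cases hm : m + 2 = k
  · subst hm
    rw [pow_add, even_two.neg_one_pow, mul_one]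
  · rw [dual_lof_apply_eq_zero hΛ k x hm, smul_zero, smul_zero]

end Parity

/-! ### On `X(ℂ)`: the parity lemma and A5 -/

variable {n : ℕ} {X : Motives.SchemeOver ℂ}

/-- Mutually inverse pull-backs fixing `ℓ` commute with every dual Lefschetz operator of `ℓ`
(uniqueness of `sl(2)`-partners on the finite-dimensional `H*(X(ℂ); ℂ)`). -/
theorem totalPullback_mul_dual (hX : Motives.IsSmoothProjective n X) {N : ℕ}
    (f g : C(Motives.ComplexPoints X, Motives.ComplexPoints X))
    (hfg : totalPullback ℂ f * totalPullback ℂ g = 1) (hgf : totalPullback ℂ g * totalPullback ℂ f = 1)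
    {ℓ : complexBetti X 2} (hℓf : singularCohomology.map ℂ ℂ f 2 ℓ = ℓ)
    (hℓg : singularCohomology.map ℂ ℂ g 2 ℓ = ℓ)
    {Λ : Module.End ℂ (totalCohomology ℂ (Motives.ComplexPoints X))} (hΛ : IsDualLefschetz N ℓ Λ) :
    totalPullback ℂ f * Λ = Λ * totalPullback ℂ f := by
  have h := IsDualLefschetz.unique hX hΛ (isDualLefschetz_conj_totalPullback f g hfg hℓf hℓg hΛ)
  calc totalPullback ℂ f * Λ = totalPullback ℂ f * Λ * (totalPullback ℂ g * totalPullback ℂ f) := by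
          rw [hgf, mul_one]
    _ = (totalPullback ℂ f * Λ * totalPullback ℂ g) * totalPullback ℂ f := by rw [← mul_assoc]
    _ = Λ * totalPullback ℂ f := by rw [← h]

/-- **Parity lemma.**  If `f^*` has a two-sided inverse `g^*`, both fix `ℓ`, `f^*` fixes `H⁰`, `H²`
and acts by `−1` on `H³`, and `(L_ℓ, h, Λ)` is an `sl(2)`-triple on `H*(X(ℂ); ℂ)`, then
`f^* = (−1)^{deg}` on the `⟨Λ, ∪⟩`-span of `H⁰ ∪ H² ∪ H³`. -/
theorem totalPullback_eq_parityOp_of_mem_opCupSpan (hX : Motives.IsSmoothProjective n X) {N : ℕ}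
    (f g : C(Motives.ComplexPoints X, Motives.ComplexPoints X))
    (hfg : totalPullback ℂ f * totalPullback ℂ g = 1) (hgf : totalPullback ℂ g * totalPullback ℂ f = 1)
    (h0 : ∀ c : complexBetti X 0, singularCohomology.map ℂ ℂ f 0 c = c)
    (h2 : ∀ c : complexBetti X 2, singularCohomology.map ℂ ℂ f 2 c = c)
    (h3 : ∀ c : complexBetti X 3, singularCohomology.map ℂ ℂ f 3 c = -c)
    {ℓ : complexBetti X 2} (hℓg : singularCohomology.map ℂ ℂ g 2 ℓ = ℓ)
    {Λ : Module.End ℂ (totalCohomology ℂ (Motives.ComplexPoints X))}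
    (hΛ : IsDualLefschetz N ℓ Λ) {v : totalCohomology ℂ (Motives.ComplexPoints X)}
    (hv : v ∈ opCupSpan ℂ (Motives.ComplexPoints X) Λ
      (degreeClasses ℂ (Motives.ComplexPoints X) {0, 2, 3})) :
    totalPullback ℂ f v = parityOp (Motives.ComplexPoints X) v := by
  let S : Submodule ℂ (totalCohomology ℂ (Motives.ComplexPoints X)) :=
    LinearMap.eqLocus (totalPullback ℂ f) (parityOp (Motives.ComplexPoints X))
  suffices hle : opCupSpan ℂ (Motives.ComplexPoints X) Λ
      (degreeClasses ℂ (Motives.ComplexPoints X) {0, 2, 3}) ≤ S from hle hv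
  refine opCupSpan_le ?_ ?_ ?_
  · -- generators
    intro v hv
    rw [degreeClasses, Set.mem_iUnion₂] at hv
    obtain ⟨k, hk, x, rfl⟩ := hv
    change totalPullback ℂ f _ = parityOp _ _
    rw [totalPullback_lof, parityOp_lof]
    simp only [Set.mem_insert_iff, Set.mem_singleton_iff] at hk
    rcases hk with rfl | rfl | rfl
    · rw [h0, pow_zero, one_smul]
    · rw [h2, even_two.neg_one_pow, one_smul]
    · rw [h3, map_neg, pow_succ, even_two.neg_one_pow, one_mul, neg_one_smul]
  · -- cup-closed
    intro x hx y hy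
    change totalPullback ℂ f _ = parityOp _ _
    rw [totalPullback_totalCup, parityOp_totalCup, LinearMap.mem_eqLocus.mp hx,
      LinearMap.mem_eqLocus.mp hy]
  · -- `Λ`-stable
    intro x hx
    change totalPullback ℂ f _ = parityOp _ _
    rw [← Module.End.mul_apply, totalPullback_mul_dual hX f g hfg hgf (h2 ℓ) hℓg hΛ,
      Module.End.mul_apply, LinearMap.mem_eqLocus.mp hx, ← Module.End.mul_apply,
      ← parityOp_mul_dual hΛ, Module.End.mul_apply]

/-- **A5 from L1 and André's dual-Lefschetz fact: the Kummer involution fixes `H⁸(X(ℂ); ℂ)^Γ`.** -/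
theorem kum4InvolutionFixesInvariantMiddleClasses_of
    (hS1 : Andre1996_dualLefschetz_mem_adjoin_lefschetzInvolution) (hL1 : LefschetzGenerationKum4) :
    ∀ ⦃X : Motives.SchemeOver ℂ⦄, Motives.IsSmoothProjective 8 X → IsOfGeneralizedKummerType 4 X →
      ∀ ι : Aut X, complexBetti.map ι.hom 2 = 𝟙 _ → complexBetti.map ι.hom 3 = -𝟙 _ →
        ∀ c : complexBetti X 8, IsGammaInvariant X c → (complexBetti.map ι.hom 8).hom c = c := by
  intro X hX hK ι hι2 hι3 c hc
  -- an `sl(2)`-triple from a polarization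
  obtain ⟨η, hη⟩ := exists_isPolarizationClass hX
  obtain ⟨Λ, hΛ⟩ := hS1.hasDualLefschetz_of_isPolarizationClass (by norm_num) hX hη
  -- the pull-backs of `ι` and `ι⁻¹`
  set f := Motives.AlgPoints.mapContinuous (L := ℂ) ι.hom with hf
  set g := Motives.AlgPoints.mapContinuous (L := ℂ) ι.inv with hg
  have hfg : totalPullback ℂ f * totalPullback ℂ g = 1 := by
    rw [← totalPullback_comp_eq_mul, hf, hg, ← Motives.AlgPoints.mapContinuous_comp, ι.hom_inv_id,
      Motives.AlgPoints.mapContinuous_id, totalPullback_id_eq_one]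
  have hgf : totalPullback ℂ g * totalPullback ℂ f = 1 := by
    rw [← totalPullback_comp_eq_mul, hf, hg, ← Motives.AlgPoints.mapContinuous_comp, ι.inv_hom_id,
      Motives.AlgPoints.mapContinuous_id, totalPullback_id_eq_one]
  have h2 : ∀ a : complexBetti X 2, singularCohomology.map ℂ ℂ f 2 a = a := by
    intro a
    change (complexBetti.map ι.hom 2).hom a = a
    rw [hι2]; rfl
  have h3 : ∀ a : complexBetti X 3, singularCohomology.map ℂ ℂ f 3 a = -a := by
    intro a
    change (complexBetti.map ι.hom 3).hom a = -a
    rw [hι3]; rfl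
  have h0 : ∀ a : complexBetti X 0, singularCohomology.map ℂ ℂ f 0 a = a := by
    intro a
    obtain ⟨r, rfl⟩ := exists_eq_smul_one_of_isSmoothProjective hX ℂ a
    rw [map_smul, singularCohomology.map_one]
  have hι2' : complexBetti.map ι.inv 2 = 𝟙 _ := by
    have h : complexBetti.map (ι.inv ≫ ι.hom) 2 = 𝟙 _ := by rw [ι.inv_hom_id]; exact complexBetti.map_id _
    rw [complexBetti.map_comp, hι2, Category.id_comp] at h
    exact h
  have hηg : singularCohomology.map ℂ ℂ g 2 η = η := by
    change (complexBetti.map ι.inv 2).hom η = η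
    rw [hι2']; rfl
  -- `c` lies in the span, where `ι^* = (+1)` in degree `8`
  have hmem := hL1 hX hK η Λ hΛ (ofDegree_mem_gammaInvariantClasses hc)
  have key := totalPullback_eq_parityOp_of_mem_opCupSpan hX f g hfg hgf h0 h2 h3 hηg hΛ hmem
  rw [totalPullback_lof, parityOp_lof, show ((-1 : ℂ) ^ 8) = 1 by norm_num, one_smul] at key
  have := congrArg (DirectSum.component ℂ ℕ _ 8) key
  simpa [ofDegree] using this

end Summit.Ventures.HodgeKum4

end
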